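import Summits.QuantumFields.BalabanUV.Beta.EriceFlowEnclosureLogMeanClockIntegralLimit
import Summits.QuantumFields.BalabanUV.Beta.EriceFlowEnclosureCesaroClockSamplingRate

/-!
# Beta / EriceFlowEnclosureLogMeanClockIntegralRate — THE TWO LOGARITHMIC AVERAGES ARE ONE, WITH A RATE ALONG A GENERAL CLOCK
# (gen 38 OPEN (b)): for M continuous, bounded by B and C-log-Lipschitz on ]0, δ[, `0 < c < δ`, and a clock `h_n > 0`, `n·h_n → L₀ > 0`
# whose LOGARITHMIC DEFECT `d_n := |log((n+1)·h_n ∕ L₀)|` is ℓ-SUMMABLE, `Σ_n d_n∕(n+1) < ∞`, there are K and N₁ with, for all N ≥ N₁,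
#     **`|(Σ_{n<N} M(h_n)∕(n+1))∕H_N − (∫_{h_N}^{c} M ds∕s)∕log(c∕h_N)| ≤ K ∕ log(N+1)`**
# — P2 #55b's ideal-clock rate `K∕log(N+1)` survives along every such clock (the two-clock step costs `C·Σ_n d_n∕(n+1)` ONCE, not per
# decade; the two-point step costs `4B·d_N∕log(N+1)`); and the clock RATE of row L119 (`|n·h_n − L₀| ≤ A(1 + log n)∕n`, P2 #51h-A
# `clock_rate` along every (3.62) trajectory under (T)) makes the defect ℓ-summable (`d_n∕(n+1) = O((1 + log n)∕n²)`), so the rate holds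
# along the bare couplings (P2 #56b files it by name for the 1∕K letter deviation).  Pure [folklore]; by name over P2 #55b
# (`ideal_logCutoffAverage_rate`, `logScale_two_point`), P2 #55a (masses), P2 #53b (`logLip_abs`, `clock_tendsto_zero`), P2 #53e
# (`abs_log_clock_le`), Mathlib `Real.summable_nat_rpow_inv`, `Summable.of_norm_bounded_eventually_nat`, `Summable.sum_le_tsum`.
#   §1 THE ℓ-MEAN OF AN ℓ-SUMMABLE SEQUENCE IS O(1∕H_N): `logSum_abs_le_tsum`, `logMean_abs_le_of_summable`;
#   §2 THE SAMPLE DEFECT: `sample_defect_le` (`|M(h_n) − M(L₀∕(n+1))| ≤ C·d_n`), `succ_clock_tendsto`, `defect_tendsto_zero`,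
#      `sampleDefect_summable`;
#   §3 TWO POINTS AGAINST THE MASS: `twoPoint_ideal_le` (`|L(L₀∕(N+1)) − L(h_N)| ≤ 2B·d_N∕(log(N+1) + log(c∕L₀))`);
#   §4 HEADLINE **`logCutoffAverage_rate`**;
#   §5 THE CLOCK RATE MAKES THE DEFECT SUMMABLE: `one_add_log_le_two_sqrt`, `summable_inv_mul_sqrt`, **`defect_summable_of_clockRate`**,
#      END **`logCutoffAverage_rate_of_clockRate`**.
# (β-flow team, prover 2 = lower ∕ positivity side, unit `b2b-balaban-beta-bflow-p2`, gen 39; module P2 #56a; no Erice sentence occurs)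

HONEST FRAMING (page 1 of everything the β sub-cell writes): discharging `BetaPertH` makes Bałaban's UV stability UNCONDITIONAL — a
real constructive-QFT result; it is NOT the continuum limit and NOT the Clay problem.  HONEST DEPENDENCY (cell reorg 2026-08-19,
verbatim): «continuum YM on T⁴ ⇐ BetaPertH ∧ nine spine estimates (0/9 proved); BetaPertH ⇐ (D1) ∧ (D4) ∧ CAP+tail; G-an2-4 gates
asym, D1 and NE2/3/4.»  THIS MODULE DISCHARGES NOTHING and quotes nothing: [folklore] real analysis (shapes: M = the three-loop Cesàro mean,
h = the cutoff couplings with the two-loop clock of row L119; Hardy, Divergent Series §§3.8, 4.16 — the second theorem of consistency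
(R, log n, 1) ∼ (ℓ), quantified along a perturbed clock).

THE POINT.  `S_N − S^ideal_N = Σ_{n<N} (M(h_n) − M(L₀∕(n+1)))∕(n+1)` is bounded by `C·Σ_n d_n∕(n+1)` UNIFORMLY IN N when the defect is
ℓ-summable; the ideal clock carries P2 #55b's `K∕log(N+1)`; and the log-scale average moves by `≤ 2B·d_N∕log(c(N+1)∕L₀)` between the
ideal coupling and `h_N` (P2 #55b `logScale_two_point`, whose denominator IS the mass).  Mere convergence `n·h_n → L₀` gives only o(1)
(P2 #55c); a clock rate `(1 + log n)∕n` gives `d_n = O((1 + log n)∕n)` and `Σ d_n∕(n+1) < ∞` (`(1 + log n)∕n² ≤ 2∕(n√n)`).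

WHAT THIS FILE PROVES (0 sorry, 0 def): §1 `logSum_abs_le_tsum`, `logMean_abs_le_of_summable`; §2 `sample_defect_le`, `succ_clock_tendsto`,
`defect_tendsto_zero`, `sampleDefect_summable`; §3 `twoPoint_ideal_le`; §4 HEADLINE **`logCutoffAverage_rate`**; §5 `one_add_log_le_two_sqrt`,
`summable_inv_mul_sqrt`, **`defect_summable_of_clockRate`**, END **`logCutoffAverage_rate_of_clockRate`**.
NOT CLAIMED: a rate without ℓ-summability of the defect (then only o(1), P2 #55c — and no better in general: the ℓ-mean of `C·d_n` is the
exact size of the two-clock step for monotone defects); the β-side transfer (P2 #56b); `BetaPertH`; continuum; Clay.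
-/

namespace Summit.QuantumFields.BalabanUV.Beta.EriceFlowEnclosureLogMeanClockIntegralRate

open Set Filter Topology MeasureTheory intervalIntegral
open Summit.QuantumFields.BalabanUV.Beta.EriceFlowEnclosureCesaroClockSampling (logLip_abs clock_tendsto_zero)
open Summit.QuantumFields.BalabanUV.Beta.EriceFlowEnclosureCesaroClockSamplingRate (abs_log_clock_le)
open Summit.QuantumFields.BalabanUV.Beta.EriceFlowEnclosureLogMeanSeq (logMass_pos)
open Summit.QuantumFields.BalabanUV.Beta.EriceFlowEnclosureWeightedClockSampling (escape_clock)
open Summit.QuantumFields.BalabanUV.Beta.EriceFlowEnclosureLogMeanClockIntegral (log_succ_le_logMass)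
open Summit.QuantumFields.BalabanUV.Beta.EriceFlowEnclosureLogMeanClockIntegralLimit

noncomputable section

variable {M : ℝ → ℝ} {δ C B L₀ : ℝ}

/-! ## §1 The ℓ-mean of an ℓ-summable sequence is O(1∕H_N) -/

/-- If `Σ_n |a_n|∕(n+1) < ∞` then every partial sum `|Σ_{n<N} a_n∕(n+1)|` is bounded by the full sum `Σ_n |a_n|∕(n+1)`. [folklore] -/
theorem logSum_abs_le_tsum {a : ℕ → ℝ} (ha : Summable fun n : ℕ => ((n : ℝ) + 1)⁻¹ * |a n|) (N : ℕ) :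
    |∑ n ∈ Finset.range N, ((n : ℝ) + 1)⁻¹ * a n| ≤ ∑' n : ℕ, ((n : ℝ) + 1)⁻¹ * |a n| := by
  calc |∑ n ∈ Finset.range N, ((n : ℝ) + 1)⁻¹ * a n| ≤ ∑ n ∈ Finset.range N, |((n : ℝ) + 1)⁻¹ * a n| :=
        Finset.abs_sum_le_sum_abs _ _
    _ = ∑ n ∈ Finset.range N, ((n : ℝ) + 1)⁻¹ * |a n| :=
        Finset.sum_congr rfl fun n _ => by rw [abs_mul, abs_of_pos (by positivity : (0:ℝ) < ((n : ℝ) + 1)⁻¹)]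
    _ ≤ ∑' n : ℕ, ((n : ℝ) + 1)⁻¹ * |a n| := Summable.sum_le_tsum _ (fun n _ => by positivity) ha

/-- **THE ℓ-MEAN OF AN ℓ-SUMMABLE SEQUENCE IS O(1∕log N)**: `|(Σ_{n<N} a_n∕(n+1))∕H_N| ≤ (Σ_n |a_n|∕(n+1))∕log(N+1)` for N ≥ 1
(`H_N ≥ log(N+1)`, P2 #55a). [folklore] -/
theorem logMean_abs_le_of_summable {a : ℕ → ℝ} (ha : Summable fun n : ℕ => ((n : ℝ) + 1)⁻¹ * |a n|) {N : ℕ} (hN : 1 ≤ N) :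
    |(∑ n ∈ Finset.range N, ((n : ℝ) + 1)⁻¹ * a n) / (∑ n ∈ Finset.range N, ((n : ℝ) + 1)⁻¹)|
      ≤ (∑' n : ℕ, ((n : ℝ) + 1)⁻¹ * |a n|) / Real.log ((N : ℝ) + 1) := by
  have hH0 : 0 < ∑ n ∈ Finset.range N, ((n : ℝ) + 1)⁻¹ := logMass_pos hN
  have hlog : 0 < Real.log ((N : ℝ) + 1) := Real.log_pos (by
    have : (1:ℝ) ≤ N := by exact_mod_cast hN
    linarith)
  have hA0 : 0 ≤ ∑' n : ℕ, ((n : ℝ) + 1)⁻¹ * |a n| := tsum_nonneg fun n => by positivity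
  rw [abs_div, abs_of_pos hH0]
  calc |∑ n ∈ Finset.range N, ((n : ℝ) + 1)⁻¹ * a n| / ∑ n ∈ Finset.range N, ((n : ℝ) + 1)⁻¹
      ≤ (∑' n : ℕ, ((n : ℝ) + 1)⁻¹ * |a n|) / ∑ n ∈ Finset.range N, ((n : ℝ) + 1)⁻¹ :=
        div_le_div_of_nonneg_right (logSum_abs_le_tsum ha N) hH0.le
    _ ≤ (∑' n : ℕ, ((n : ℝ) + 1)⁻¹ * |a n|) / Real.log ((N : ℝ) + 1) :=
        div_le_div_of_nonneg_left hA0 hlog (log_succ_le_logMass N)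

/-! ## §2 The sample defect against the ideal clock -/

/-- THE SAMPLE DEFECT: for `h_n, L₀∕(n+1) ∈ ]0, δ[` and M C-log-Lipschitz on ]0, δ[:
**`|M(h_n) − M(L₀∕(n+1))| ≤ C·|log((n+1)·h_n∕L₀)|`** (P2 #53b `logLip_abs`; `h_n∕(L₀∕(n+1)) = (n+1)h_n∕L₀`). [folklore] -/
theorem sample_defect_le (hlip : ∀ t u : ℝ, 0 < t → t ≤ u → u < δ → |M u - M t| ≤ C * Real.log (u / t))
    (hL₀ : 0 < L₀) {h : ℕ → ℝ} {n : ℕ} (hn : 0 < h n) (hnδ : h n < δ) (hiδ : L₀ / ((n : ℝ) + 1) < δ) :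
    |M (h n) - M (L₀ / ((n : ℝ) + 1))| ≤ C * |Real.log (((n : ℝ) + 1) * h n / L₀)| := by
  have hn1 : (0:ℝ) < (n : ℝ) + 1 := by positivity
  have hi0 : 0 < L₀ / ((n : ℝ) + 1) := div_pos hL₀ hn1
  have hl := logLip_abs hlip hi0 hiδ hn hnδ
  have hq : h n / (L₀ / ((n : ℝ) + 1)) = ((n : ℝ) + 1) * h n / L₀ := by
    field_simp
  rwa [hq] at hl

/-- The shifted clock: `n·h_n → L₀ ⟹ (n+1)·h_n → L₀` (`h_n → 0`, P2 #53b). [folklore] -/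
theorem succ_clock_tendsto {h : ℕ → ℝ} (hclock : Tendsto (fun n : ℕ => (n : ℝ) * h n) atTop (𝓝 L₀)) :
    Tendsto (fun n : ℕ => ((n : ℝ) + 1) * h n) atTop (𝓝 L₀) := by
  have := hclock.add (clock_tendsto_zero hclock)
  rw [add_zero] at this
  exact this.congr fun n => by ring

/-- THE DEFECT IS NULL along every clock: `log((n+1)·h_n∕L₀) → 0`. [folklore] -/
theorem defect_tendsto_zero {h : ℕ → ℝ} (hL₀ : 0 < L₀) (hclock : Tendsto (fun n : ℕ => (n : ℝ) * h n) atTop (𝓝 L₀)) :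
    Tendsto (fun n : ℕ => Real.log (((n : ℝ) + 1) * h n / L₀)) atTop (𝓝 0) := by
  have h1 : Tendsto (fun n : ℕ => ((n : ℝ) + 1) * h n / L₀) atTop (𝓝 1) := by
    have := (succ_clock_tendsto hclock).div_const L₀
    rwa [div_self hL₀.ne'] at this
  have h2 := (Real.continuousAt_log one_ne_zero).tendsto.comp h1
  rwa [Real.log_one] at h2

/-- **AN ℓ-SUMMABLE DEFECT MAKES THE WEIGHTED SAMPLE DEFECTS SUMMABLE**: `Σ_n |log((n+1)h_n∕L₀)|∕(n+1) < ∞` and the clock ⟹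
`Σ_n |M(h_n) − M(L₀∕(n+1))|∕(n+1) < ∞` (§2's bound holds from the index where both couplings are below δ). [folklore] -/
theorem sampleDefect_summable (hδ : 0 < δ)
    (hlip : ∀ t u : ℝ, 0 < t → t ≤ u → u < δ → |M u - M t| ≤ C * Real.log (u / t))
    {h : ℕ → ℝ} (hpos : ∀ n, 0 < h n) (hL₀ : 0 < L₀)
    (hclock : Tendsto (fun n : ℕ => (n : ℝ) * h n) atTop (𝓝 L₀))
    (hdef : Summable fun n : ℕ => ((n : ℝ) + 1)⁻¹ * |Real.log (((n : ℝ) + 1) * h n / L₀)|) :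
    Summable fun n : ℕ => ((n : ℝ) + 1)⁻¹ * |M (h n) - M (L₀ / ((n : ℝ) + 1))| := by
  obtain ⟨hipos, hiclock⟩ := escape_clock hL₀
  refine Summable.of_norm_bounded_eventually_nat (hdef.mul_left C) ?_
  filter_upwards [(clock_tendsto_zero hclock).eventually (gt_mem_nhds hδ),
    (clock_tendsto_zero hiclock).eventually (gt_mem_nhds hδ)] with n hnδ hiδ
  rw [Real.norm_eq_abs, abs_mul, abs_abs, abs_of_pos (by positivity : (0:ℝ) < ((n : ℝ) + 1)⁻¹), ← mul_assoc,
    mul_comm C, mul_assoc]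
  exact mul_le_mul_of_nonneg_left (sample_defect_le hlip hL₀ (hpos n) hnδ hiδ) (by positivity)

/-! ## §3 Two points against the mass -/

/-- **TWO POINTS AGAINST THE MASS.**  M continuous on ]0, δ[ with `|M| ≤ B`, `0 < c < δ`, L₀ > 0, and BOTH couplings `L₀∕(N+1)` and `h_N`
in `]0, c∕e]`.  With `L(x) = (∫_x^c M ds∕s)∕log(c∕x)` and `d_N = |log((N+1)h_N∕L₀)|`:
**`|L(L₀∕(N+1)) − L(h_N)| ≤ 2B·d_N∕(log(N+1) + log(c∕L₀))`** — P2 #55b `logScale_two_point` from the smaller of the two couplings, whose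
denominator `log(c∕min) ≥ log(c(N+1)∕L₀)` is the mass. [folklore] -/
theorem twoPoint_ideal_le (hcont : ContinuousOn M (Ioo 0 δ)) (hB : ∀ s ∈ Ioo 0 δ, |M s| ≤ B)
    {c : ℝ} (hc0 : 0 < c) (hcδ : c < δ) (hL₀ : 0 < L₀) {h : ℕ → ℝ} {N : ℕ} (hN : 0 < h N)
    (hic : L₀ / ((N : ℝ) + 1) ≤ c * Real.exp (-1)) (hhc : h N ≤ c * Real.exp (-1)) :
    |(∫ s in (L₀ / ((N : ℝ) + 1))..c, M s / s) / Real.log (c / (L₀ / ((N : ℝ) + 1)))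
        - (∫ s in (h N)..c, M s / s) / Real.log (c / h N)|
      ≤ 2 * B * |Real.log (((N : ℝ) + 1) * h N / L₀)| / (Real.log ((N : ℝ) + 1) + Real.log (c / L₀)) := by
  have hN1 : (0:ℝ) < (N : ℝ) + 1 := by positivity
  set t : ℝ := L₀ / ((N : ℝ) + 1) with ht
  have ht0 : 0 < t := div_pos hL₀ hN1
  have hB0 : 0 ≤ B := by
    have hce : c * Real.exp (-1) < c := by
      have he : Real.exp (-1) < 1 := Real.exp_lt_one_iff.mpr (by norm_num)
      have : c * Real.exp (-1) < c * 1 := mul_lt_mul_of_pos_left he hc0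
      linarith
    exact (abs_nonneg _).trans (hB t ⟨ht0, (hic.trans_lt hce).trans hcδ⟩)
  -- the mass: log(c/t) = log(N+1) + log(c/L₀) ≥ 1
  have hmass : Real.log (c / t) = Real.log ((N : ℝ) + 1) + Real.log (c / L₀) := by
    rw [ht, div_div_eq_mul_div, ← div_mul_eq_mul_div, Real.log_mul (div_pos hc0 hL₀).ne' hN1.ne']
    ring
  have hmass1 : 1 ≤ Real.log (c / t) := by
    rw [Real.le_log_iff_exp_le (div_pos hc0 ht0), le_div_iff₀ ht0]
    calc Real.exp 1 * t ≤ Real.exp 1 * (c * Real.exp (-1)) := mul_le_mul_of_nonneg_left hic (Real.exp_pos 1).le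
      _ = c := by rw [mul_comm, mul_assoc, ← Real.exp_add, neg_add_cancel, Real.exp_zero, mul_one]
  have hmass0 : 0 < Real.log (c / t) := lt_of_lt_of_le one_pos hmass1
  -- the defect in the two orientations
  have hratio : h N / t = ((N : ℝ) + 1) * h N / L₀ := by rw [ht]; field_simp
  rw [← hmass]
  rcases le_total t (h N) with hth | hht
  · -- t ≤ h_N: two_point from t
    have h2 := logScale_two_point hcont hB hcδ ht0 hth hhc
    have hlog0 : 0 ≤ Real.log (h N / t) := Real.log_nonneg ((one_le_div ht0).mpr hth)
    rw [hratio] at h2 hlog0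
    rwa [abs_of_nonneg hlog0]
  · -- h_N ≤ t: two_point from h_N, then enlarge the denominator log(c/h_N) ≥ log(c/t)
    have h2 := logScale_two_point hcont hB hcδ hN hht hic
    have hlog0 : 0 ≤ Real.log (t / h N) := Real.log_nonneg ((one_le_div hN).mpr hht)
    have hden : Real.log (c / t) ≤ Real.log (c / h N) :=
      Real.log_le_log (div_pos hc0 ht0) (div_le_div_of_nonneg_left hc0.le hN hht)
    have hinv : Real.log (t / h N) = -Real.log (((N : ℝ) + 1) * h N / L₀) := by
      rw [← hratio, ← Real.log_inv, inv_div]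
    have habs : |Real.log (((N : ℝ) + 1) * h N / L₀)| = Real.log (t / h N) := by
      have hx : Real.log (((N : ℝ) + 1) * h N / L₀) = -Real.log (t / h N) := by rw [hinv, neg_neg]
      rw [hx, abs_neg, abs_of_nonneg hlog0]
    rw [abs_sub_comm, habs]
    refine h2.trans ?_
    have hnum : 0 ≤ 2 * B * Real.log (t / h N) := by positivity
    exact div_le_div_of_nonneg_left hnum hmass0 hden

/-! ## §4 The rate along a general clock with ℓ-summable defect -/

/-- **HEADLINE — THE TWO LOGARITHMIC AVERAGES ARE ONE, TO O(1∕log N), ALONG EVERY CLOCK WITH ℓ-SUMMABLE DEFECT.**  M continuous on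
]0, δ[, `|M| ≤ B`, `|M u − M t| ≤ C·log(u∕t)` (0 < t ≤ u < δ; C ≥ 0); `h_n > 0` with `n·h_n → L₀ > 0` AND
`Σ_n |log((n+1)h_n∕L₀)|∕(n+1) < ∞`; `0 < c < δ`.  Then there are K and N₁ with, for all N ≥ N₁,
**`|(Σ_{n<N} M(h_n)∕(n+1))∕H_N − (∫_{h_N}^{c} M ds∕s)∕log(c∕h_N)| ≤ K∕log(N+1)`** (two clocks: `(Σ_n |defect_n|∕(n+1))∕log(N+1)`, §1–§2;
the ideal clock: P2 #55b; two points: `4B·d_N∕log(N+1) ≤ 4B∕log(N+1)` once `d_N ≤ 1` and `log(N+1) ≥ 2|log(c∕L₀)|`, §3). [folklore] -/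
theorem logCutoffAverage_rate (hδ : 0 < δ) (hC : 0 ≤ C) (hcont : ContinuousOn M (Ioo 0 δ))
    (hlip : ∀ t u : ℝ, 0 < t → t ≤ u → u < δ → |M u - M t| ≤ C * Real.log (u / t))
    (hB : ∀ s ∈ Ioo 0 δ, |M s| ≤ B) {h : ℕ → ℝ} (hpos : ∀ n, 0 < h n) (hL₀ : 0 < L₀)
    (hclock : Tendsto (fun n : ℕ => (n : ℝ) * h n) atTop (𝓝 L₀))
    (hdef : Summable fun n : ℕ => ((n : ℝ) + 1)⁻¹ * |Real.log (((n : ℝ) + 1) * h n / L₀)|)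
    {c : ℝ} (hc0 : 0 < c) (hcδ : c < δ) :
    ∃ K : ℝ, ∃ N₁ : ℕ, ∀ N : ℕ, N₁ ≤ N →
      |(∑ n ∈ Finset.range N, ((n : ℝ) + 1)⁻¹ * M (h n)) / (∑ n ∈ Finset.range N, ((n : ℝ) + 1)⁻¹)
          - (∫ s in (h N)..c, M s / s) / Real.log (c / h N)| ≤ K / Real.log ((N : ℝ) + 1) := by
  obtain ⟨hipos, hiclock⟩ := escape_clock hL₀
  have hB0 : 0 ≤ B := (abs_nonneg _).trans (hB c ⟨hc0, hcδ⟩)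
  have hce : 0 < c * Real.exp (-1) := by positivity
  -- T1: the two-clock step, uniformly
  have hsum := sampleDefect_summable hδ hlip hpos hL₀ hclock hdef
  set A : ℝ := ∑' n : ℕ, ((n : ℝ) + 1)⁻¹ * |M (h n) - M (L₀ / ((n : ℝ) + 1))| with hA
  -- T2: the ideal clock
  obtain ⟨Ki, Ni, hKi⟩ := ideal_logCutoffAverage_rate (L₀ := L₀) hδ hL₀ hC hcont hlip hB hc0 hcδ
  -- thresholds: both couplings ≤ c/e, d_N ≤ 1, log(N+1) ≥ 2|log(c/L₀)|
  obtain ⟨N₂, hN₂⟩ := eventually_atTop.mp ((clock_tendsto_zero hclock).eventually (ge_mem_nhds hce))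
  obtain ⟨N₃, hN₃⟩ := eventually_atTop.mp ((clock_tendsto_zero hiclock).eventually (ge_mem_nhds hce))
  obtain ⟨N₄, hN₄⟩ := eventually_atTop.mp
    (((continuous_abs.tendsto 0).comp (defect_tendsto_zero hL₀ hclock)).eventually
      (ge_mem_nhds (by rw [abs_zero]; exact one_pos)))
  have hlogtop : Tendsto (fun N : ℕ => Real.log ((N : ℝ) + 1)) atTop atTop :=
    Real.tendsto_log_atTop.comp (tendsto_natCast_atTop_atTop.atTop_add tendsto_const_nhds)
  obtain ⟨N₅, hN₅⟩ := eventually_atTop.mp (hlogtop.eventually_ge_atTop (2 * |Real.log (c / L₀)|))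
  refine ⟨A + Ki + 4 * B, max (max (max Ni N₂) (max N₃ N₄)) (max N₅ 1), fun N hN => ?_⟩
  have hNi : Ni ≤ N := le_trans (le_trans (le_max_left _ _) (le_max_left _ _)) (le_trans (le_max_left _ _) hN)
  have hN2 : N₂ ≤ N := le_trans (le_trans (le_max_right _ _) (le_max_left _ _)) (le_trans (le_max_left _ _) hN)
  have hN3 : N₃ ≤ N := le_trans (le_trans (le_max_left _ _) (le_max_right _ _)) (le_trans (le_max_left _ _) hN)
  have hN4 : N₄ ≤ N := le_trans (le_trans (le_max_right _ _) (le_max_right _ _)) (le_trans (le_max_left _ _) hN)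
  have hN5 : N₅ ≤ N := le_trans (le_max_left _ _) (le_trans (le_max_right _ _) hN)
  have hN1 : 1 ≤ N := le_trans (le_max_right _ _) (le_trans (le_max_right _ _) hN)
  have hlogN : 0 < Real.log ((N : ℝ) + 1) := Real.log_pos (by
    have : (1:ℝ) ≤ N := by exact_mod_cast hN1
    linarith)
  -- names
  set S : ℝ := ∑ n ∈ Finset.range N, ((n : ℝ) + 1)⁻¹ * M (h n) with hS
  set Si : ℝ := ∑ n ∈ Finset.range N, ((n : ℝ) + 1)⁻¹ * M (L₀ / ((n : ℝ) + 1)) with hSi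
  set H : ℝ := ∑ n ∈ Finset.range N, ((n : ℝ) + 1)⁻¹ with hH
  set Li : ℝ := (∫ s in (L₀ / ((N : ℝ) + 1))..c, M s / s) / Real.log (c / (L₀ / ((N : ℝ) + 1))) with hLi
  set Lh : ℝ := (∫ s in (h N)..c, M s / s) / Real.log (c / h N) with hLh
  -- T1
  have hT1 : |(S - Si) / H| ≤ A / Real.log ((N : ℝ) + 1) := by
    have hsub : S - Si = ∑ n ∈ Finset.range N, ((n : ℝ) + 1)⁻¹ * (M (h n) - M (L₀ / ((n : ℝ) + 1))) := by
      rw [hS, hSi, ← Finset.sum_sub_distrib]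
      exact Finset.sum_congr rfl fun n _ => by ring
    rw [hsub]
    exact logMean_abs_le_of_summable hsum hN1
  -- T2
  have hT2 : |Si / H - Li| ≤ Ki / Real.log ((N : ℝ) + 1) := hKi N hNi
  -- T3
  have hT3 : |Li - Lh| ≤ 4 * B / Real.log ((N : ℝ) + 1) := by
    have h3 := twoPoint_ideal_le hcont hB hc0 hcδ hL₀ (hpos N) (hN₃ N hN3) (hN₂ N hN2)
    have hd : |Real.log (((N : ℝ) + 1) * h N / L₀)| ≤ 1 := by
      have := hN₄ N hN4
      simpa only [Function.comp_apply, abs_abs] using this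
    have hden : Real.log ((N : ℝ) + 1) / 2 ≤ Real.log ((N : ℝ) + 1) + Real.log (c / L₀) := by
      have h5 := hN₅ N hN5
      linarith [neg_abs_le (Real.log (c / L₀))]
    have hden0 : 0 < Real.log ((N : ℝ) + 1) / 2 := by positivity
    refine h3.trans ?_
    calc 2 * B * |Real.log (((N : ℝ) + 1) * h N / L₀)| / (Real.log ((N : ℝ) + 1) + Real.log (c / L₀))
        ≤ 2 * B * 1 / (Real.log ((N : ℝ) + 1) / 2) := by
          refine (div_le_div_of_nonneg_left (by positivity) hden0 hden).trans ?_
          exact div_le_div_of_nonneg_right (mul_le_mul_of_nonneg_left hd (by positivity)) hden0.le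
      _ = 4 * B / Real.log ((N : ℝ) + 1) := by field_simp; ring
  -- assemble
  have hkey : S / H - Lh = (S - Si) / H + (Si / H - Li) + (Li - Lh) := by ring
  rw [hkey]
  calc |(S - Si) / H + (Si / H - Li) + (Li - Lh)| ≤ |(S - Si) / H + (Si / H - Li)| + |Li - Lh| := abs_add_le _ _
    _ ≤ |(S - Si) / H| + |Si / H - Li| + |Li - Lh| := by linarith [abs_add_le ((S - Si) / H) (Si / H - Li)]
    _ ≤ A / Real.log ((N : ℝ) + 1) + Ki / Real.log ((N : ℝ) + 1) + 4 * B / Real.log ((N : ℝ) + 1) :=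
        add_le_add (add_le_add hT1 hT2) hT3
    _ = (A + Ki + 4 * B) / Real.log ((N : ℝ) + 1) := by ring

/-! ## §5 A clock rate `(1 + log n)∕n` makes the defect ℓ-summable -/

/-- `1 + log x ≤ 2√x` for `x ≥ 1` (`log x = 2 log √x ≤ 2(√x − 1)`). [folklore] -/
theorem one_add_log_le_two_sqrt {x : ℝ} (hx : 1 ≤ x) : 1 + Real.log x ≤ 2 * Real.sqrt x := by
  have hx0 : 0 ≤ x := le_trans zero_le_one hx
  have hs0 : 0 < Real.sqrt x := Real.sqrt_pos.mpr (lt_of_lt_of_le zero_lt_one hx)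
  have hlog : Real.log x = 2 * Real.log (Real.sqrt x) := by
    rw [Real.log_sqrt hx0]; ring
  have h1 : Real.log (Real.sqrt x) ≤ Real.sqrt x - 1 := Real.log_le_sub_one_of_pos hs0
  rw [hlog]
  linarith

/-- `Σ_n 1∕(n√n) < ∞` (Mathlib `Real.summable_nat_rpow_inv` at p = 3∕2; `n^{3∕2} = n·√n`). [folklore] -/
theorem summable_inv_mul_sqrt : Summable fun n : ℕ => ((n : ℝ) * Real.sqrt n)⁻¹ := by
  have h := Real.summable_nat_rpow_inv.mpr (by norm_num : (1:ℝ) < 3 / 2)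
  refine h.congr fun n => ?_
  have hn : (0:ℝ) ≤ n := Nat.cast_nonneg n
  rw [show (3:ℝ) / 2 = 1 + 1 / 2 by norm_num]
  rcases eq_or_lt_of_le hn with hz | hp
  · rw [← hz]
    rw [Real.zero_rpow (by norm_num), zero_mul]
  · rw [Real.rpow_add hp, Real.rpow_one, Real.sqrt_eq_rpow]

/-- **A CLOCK RATE `|n·h_n − L₀| ≤ A(1 + log n)∕n` MAKES THE LOGARITHMIC DEFECT ℓ-SUMMABLE**: `h_n > 0`, L₀ > 0, `A ≥ 0` and the rate
eventually ⟹ `Σ_n |log((n+1)h_n∕L₀)|∕(n+1) < ∞`.  (`|(n+1)h_n − L₀| ≤ (2A(1 + log n) + L₀)∕n =: b_n∕n`; once `b_n∕n ≤ L₀∕2`,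
`d_n ≤ 2b_n∕(nL₀)` (P2 #53e `abs_log_clock_le`); `b_n ≤ 2(2A + L₀)√n` (§5 `one_add_log_le_two_sqrt`); so `d_n∕(n+1) ≤ (4(2A + L₀)∕L₀)∕(n√n)`.)
Row L119's two-loop clock along every (3.62) trajectory under (T) has this rate (P2 #51h-A `clock_rate`). [folklore] -/
theorem defect_summable_of_clockRate {h : ℕ → ℝ} (hpos : ∀ n, 0 < h n) (hL₀ : 0 < L₀) {A : ℝ} (hA : 0 ≤ A)
    (hrate : ∀ᶠ n : ℕ in atTop, |(n : ℝ) * h n - L₀| ≤ A * (1 + Real.log n) / n) :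
    Summable fun n : ℕ => ((n : ℝ) + 1)⁻¹ * |Real.log (((n : ℝ) + 1) * h n / L₀)| := by
  -- b_n/n → 0: (1 + log n)/n ≤ 2/√n → 0
  have hsqrt : Tendsto (fun n : ℕ => 2 / Real.sqrt (n : ℝ)) atTop (𝓝 0) := by
    have h1 : Tendsto (fun n : ℕ => Real.sqrt (n : ℝ)) atTop atTop :=
      Real.tendsto_sqrt_atTop.comp tendsto_natCast_atTop_atTop
    exact tendsto_const_nhds.div_atTop h1
  have hbn : Tendsto (fun n : ℕ => (2 * A + L₀) * (2 / Real.sqrt (n : ℝ))) atTop (𝓝 0) := by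
    have := hsqrt.const_mul (2 * A + L₀); rwa [mul_zero] at this
  have hsmall : ∀ᶠ n : ℕ in atTop, (2 * A + L₀) * (2 / Real.sqrt (n : ℝ)) ≤ L₀ / 2 :=
    hbn.eventually (ge_mem_nhds (by positivity))
  refine Summable.of_norm_bounded_eventually_nat (summable_inv_mul_sqrt.mul_left (4 * (2 * A + L₀) / L₀)) ?_
  filter_upwards [hrate, hsmall, eventually_ge_atTop 1] with n hn hsm hn1
  have hn0 : (0:ℝ) < n := by exact_mod_cast hn1
  have hn1' : (1:ℝ) ≤ n := by exact_mod_cast hn1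
  have hsq0 : 0 < Real.sqrt (n : ℝ) := Real.sqrt_pos.mpr hn0
  have hsq1 : 1 ≤ Real.sqrt (n : ℝ) := by rw [← Real.sqrt_one]; exact Real.sqrt_le_sqrt hn1'
  have hlog0 : 0 ≤ Real.log (n : ℝ) := Real.log_nonneg hn1'
  have hls : 1 + Real.log (n : ℝ) ≤ 2 * Real.sqrt n := one_add_log_le_two_sqrt hn1'
  -- h_n ≤ (L₀ + A(1 + log n))/n
  have hhn : h n ≤ (L₀ + A * (1 + Real.log n)) / n := by
    rw [le_div_iff₀ hn0]
    have h1 := (abs_le.mp hn).2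
    have h2 : A * (1 + Real.log ↑n) / ↑n ≤ A * (1 + Real.log ↑n) := by
      rw [div_le_iff₀ hn0]
      have : 0 ≤ A * (1 + Real.log ↑n) := by positivity
      nlinarith
    nlinarith
  -- |(n+1)h_n − L₀| ≤ b_n/n with b_n = 2A(1+log n) + L₀ ≤ 2(2A+L₀)√n, i.e. ≤ (2A+L₀)·2/√n
  have hb : |((n : ℝ) + 1) * h n - L₀| ≤ (2 * A + L₀) * (2 / Real.sqrt (n : ℝ)) := by
    have hstep : |((n : ℝ) + 1) * h n - L₀| ≤ |(n : ℝ) * h n - L₀| + h n := by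
      have : ((n : ℝ) + 1) * h n - L₀ = ((n : ℝ) * h n - L₀) + h n := by ring
      rw [this]
      exact (abs_add_le _ _).trans (by rw [abs_of_pos (hpos n)])
    have hb1 : |(n : ℝ) * h n - L₀| + h n ≤ (2 * A * (1 + Real.log n) + L₀) / n := by
      refine (add_le_add hn hhn).trans (le_of_eq ?_)
      field_simp
      ring
    have hb2 : 2 * A * (1 + Real.log ↑n) + L₀ ≤ (2 * A + L₀) * (2 * Real.sqrt n) := by
      have : 2 * A * (1 + Real.log ↑n) + L₀ ≤ (2 * A + L₀) * (1 + Real.log ↑n) := by nlinarith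
      exact this.trans (mul_le_mul_of_nonneg_left hls (by positivity))
    have hsn : 2 * Real.sqrt (n : ℝ) / n = 2 / Real.sqrt n := by
      rw [div_eq_div_iff hn0.ne' hsq0.ne', mul_assoc, Real.mul_self_sqrt hn0.le]
    calc |((n : ℝ) + 1) * h n - L₀| ≤ |(n : ℝ) * h n - L₀| + h n := hstep
      _ ≤ (2 * A * (1 + Real.log n) + L₀) / n := hb1
      _ ≤ (2 * A + L₀) * (2 * Real.sqrt n) / n := div_le_div_of_nonneg_right hb2 hn0.le
      _ = (2 * A + L₀) * (2 / Real.sqrt ↑n) := by rw [mul_div_assoc, hsn]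
  -- the logarithmic form
  set l : ℝ := (2 * A + L₀) * (2 / Real.sqrt (n : ℝ)) / L₀ with hl
  have hl2 : l ≤ 1 / 2 := by
    rw [hl, div_le_iff₀ hL₀]; linarith
  have hxl : |((n : ℝ) + 1) * h n - L₀| ≤ l * L₀ := by
    rw [hl, div_mul_cancel₀ _ hL₀.ne']; exact hb
  have hlog := abs_log_clock_le hL₀ hl2 hxl
  have hx0 : 0 < ((n : ℝ) + 1) * h n := mul_pos (by positivity) (hpos n)
  rw [← Real.log_div hx0.ne' hL₀.ne'] at hlog
  -- the weighted defect
  rw [Real.norm_eq_abs, abs_mul, abs_abs, abs_of_pos (by positivity : (0:ℝ) < ((n : ℝ) + 1)⁻¹)]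
  have hinv : ((n : ℝ) + 1)⁻¹ ≤ ((n : ℝ))⁻¹ := inv_anti₀ hn0 (by linarith)
  calc ((n : ℝ) + 1)⁻¹ * |Real.log (((n : ℝ) + 1) * h n / L₀)| ≤ ((n : ℝ))⁻¹ * (2 * l) :=
        mul_le_mul hinv hlog (abs_nonneg _) (by positivity)
    _ = 4 * (2 * A + L₀) / L₀ * ((n : ℝ) * Real.sqrt n)⁻¹ := by
        rw [hl]
        field_simp
        ring

/-- **END — THE RATE ALONG EVERY CLOCK WITH THE TWO-LOOP RATE.**  M continuous on ]0, δ[, `|M| ≤ B`, C-log-Lipschitz (C ≥ 0); `h_n > 0`,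
`n·h_n → L₀ > 0` with `|n·h_n − L₀| ≤ A(1 + log n)∕n` eventually (A ≥ 0); `0 < c < δ`.  Then there are K and N₁ with, for all N ≥ N₁,
**`|(Σ_{n<N} M(h_n)∕(n+1))∕H_N − (∫_{h_N}^{c} M ds∕s)∕log(c∕h_N)| ≤ K∕log(N+1)`**. [folklore] -/
theorem logCutoffAverage_rate_of_clockRate (hδ : 0 < δ) (hC : 0 ≤ C) (hcont : ContinuousOn M (Ioo 0 δ))
    (hlip : ∀ t u : ℝ, 0 < t → t ≤ u → u < δ → |M u - M t| ≤ C * Real.log (u / t))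
    (hB : ∀ s ∈ Ioo 0 δ, |M s| ≤ B) {h : ℕ → ℝ} (hpos : ∀ n, 0 < h n) (hL₀ : 0 < L₀)
    (hclock : Tendsto (fun n : ℕ => (n : ℝ) * h n) atTop (𝓝 L₀)) {A : ℝ} (hA : 0 ≤ A)
    (hrate : ∀ᶠ n : ℕ in atTop, |(n : ℝ) * h n - L₀| ≤ A * (1 + Real.log n) / n)
    {c : ℝ} (hc0 : 0 < c) (hcδ : c < δ) :
    ∃ K : ℝ, ∃ N₁ : ℕ, ∀ N : ℕ, N₁ ≤ N →
      |(∑ n ∈ Finset.range N, ((n : ℝ) + 1)⁻¹ * M (h n)) / (∑ n ∈ Finset.range N, ((n : ℝ) + 1)⁻¹)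
          - (∫ s in (h N)..c, M s / s) / Real.log (c / h N)| ≤ K / Real.log ((N : ℝ) + 1) :=
  logCutoffAverage_rate hδ hC hcont hlip hB hpos hL₀ hclock (defect_summable_of_clockRate hpos hL₀ hA hrate) hc0 hcδ

end

end Summit.QuantumFields.BalabanUV.Beta.EriceFlowEnclosureLogMeanClockIntegralRate
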